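import Summits.FinalStateConjecture.FinalStateConjecture.Theorems.ClusterCompletenessRecurrentlyFlatDispersesStubAnchorCone
import Summits.FinalStateConjecture.FinalStateConjecture.Theorems.ClusterCompletenessRecurrentlyFlatDispersesStubChartFuture
import Summits.FinalStateConjecture.FinalStateConjecture.Theorems.ClusterCompletenessRecurrentlyFlatDispersesFutureSetCone

/-!
# Crux `RecurrentlyFlatDisperses` (stmt-FinalStateConjecture-14665), line `Sketch` — RESTART:
# the anchored hypothesis is inherited by every later initial time

Continuation lead c5, 2026-08-16 (brick on the `stub_decomp` side). The crux hypothesis `Hyp` on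
an anchored flat late chart `Ψ₀ : U₀ → 𝒟` of a maximal vacuum Cauchy development consists of five
conjuncts in the initial chart time `τ₀` and the region `O`:
`IsLateChart (Minkowski.backgroundOn U₀) O τ₀ Ψ₀`; `{x⁰ > τ₀} ⊆ U₀`;
`O = exteriorOf 𝒟 W`, `W := Ψ₀{x⁰ > τ₀}`; `∀ τ₁ > τ₀, O \ Ψ₀{x⁰ > τ₁} ⊆ J⁻(Ψ₀{x⁰ = τ₁})`;
`∀ τ > τ₀, deviationCk … Ψ₀ 0 τ ≤ 1/4`. This file proves that `Hyp` at `τ₀` implies `Hyp` at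
every later time `τ > τ₀`, with the SAME chart `Ψ₀` and domain `U₀` and with the region replaced by
`exteriorOf 𝒟 W_τ`, `W_τ := Ψ₀{x⁰ > τ}` (`hyp_of_lt`; the third conjunct of the conclusion is the
reflexive equation, kept so that the conclusion is literally an instance of the hypothesis shape
and every landed brick of the line applies verbatim at the later time). Hence every future
argument on the crux may start at an arbitrarily late — e.g. `ε`-good — slab without losing the
hypothesis shape.

The only geometric input is that the late image is past-full along the chart verticals:
`W_τ ⊆ I⁻(W_τ)` (`Restart.image_lateRegion_subset_chronologicalPast`), because the chart-vertical
curve `s ↦ Ψ₀(x + δ(eˢ − 1)∂₀)`, `δ = x⁰ − τ₀`, through a late point `Ψ₀ x` is a future TIMELIKE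
curve (`g(dΨ₀ ∂₀, dΨ₀ ∂₀) ≤ −3/4` by the pointwise anchor, landed `stub_anchorCone` and
`FutureSet.val_mfderiv_basisVector_zero_le`; `dΨ₀ ∂₀` future-directed, landed `stub_chartFuture`)
reaching `Ψ₀(x + s ∂₀)` for every `s > 0` (`Restart.mem_chronologicalFuture_of_eq_add_smul`). The
remaining conjuncts are bookkeeping: the open embedding restricts from `{x⁰ > τ₀}` to its open
subset `{x⁰ > τ}` (`Topology.IsOpenEmbedding.inclusion`), `exteriorOf` is monotone in the charted
set (`I⁻` is), and the exhaustion and anchor conjuncts at `τ₀` specialise to times `> τ > τ₀`.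

* `Restart.mem_chronologicalFuture_of_eq_add_smul` — `Ψ₀(x + s∂₀) ∈ I⁺(Ψ₀ x)` for `s > 0`, for any
  smooth chart map on an open `U₀ ⊇ {x⁰ > τ₀}` whose vertical differential is uniformly timelike
  and future-directed on the late region;
* `Restart.image_lateRegion_subset_chronologicalPast` — `W_τ ⊆ I⁻(W_τ)` for `τ ≥ τ₀`, same setting;
* `Restart.exteriorOf_mono` — `exteriorOf 𝒟 U ⊆ exteriorOf 𝒟 U'` for `U ⊆ U'`;
* `hyp_of_lt` — the crux-vocabulary restart lemma (hypotheses = the crux's anchored conjuncts,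
  verbatim).

Mathlib + the Statement cone + landed bricks only; no definitions, no named facts.
-/

noncomputable section

open scoped Manifold ContDiff Topology
open Bundle Filter Set Function TopologicalSpace Literature.Geometry.Lorentzian

namespace Summit.FinalStateConjecture.FinalStateConjecture.Theorems.RecurrentlyFlatDisperses

namespace Restart

/-! ### The vertical exponential ray of the chart (as in `stub_chartFuture`, `FutureSet`,
`FutureDistance`) -/

-- copied from `Summits/FinalStateConjecture/FinalStateConjecture/Theorems/
--   ClusterCompletenessRecurrentlyFlatDispersesFutureDistance.lean` (private there):
-- `hasDerivAt_vert`, `vert_apply_zero`, `contDiff_vert`, `velocity_vert`, `val_smul_smul`,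
-- `velocity_comp'`, `vertical_lift`.

/-- The chart-vertical curve `s ↦ x₀ + δ(eˢ - 1) ∂₀` of `E4` has derivative `δ eᵗ ∂₀` at `t`. -/
private theorem hasDerivAt_vert (x₀ : E4) (δ t : ℝ) :
    HasDerivAt (fun s : ℝ ↦ x₀ + (δ * (Real.exp s - 1)) • (E4.basisVector 0 : E4))
      ((δ * Real.exp t) • (E4.basisVector 0 : E4)) t := by
  have h1 : HasDerivAt (fun s : ℝ ↦ δ * (Real.exp s - 1)) (δ * Real.exp t) t := by
    simpa using ((Real.hasDerivAt_exp t).sub_const 1).const_mul δ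
  simpa using (h1.smul_const (E4.basisVector 0 : E4)).const_add x₀

/-- The time coordinate along the chart-vertical curve is `x₀⁰ + δ(eˢ - 1)`. -/
private theorem vert_apply_zero (x₀ : E4) (δ s : ℝ) :
    (x₀ + (δ * (Real.exp s - 1)) • (E4.basisVector 0 : E4)) 0 = x₀ 0 + δ * (Real.exp s - 1) := by
  simp [E4.basisVector]

/-- The chart-vertical curve is smooth (as a map `ℝ → E4`). -/
private theorem contDiff_vert (x₀ : E4) (δ : ℝ) :
    ContDiff ℝ ∞ (fun s : ℝ ↦ x₀ + (δ * (Real.exp s - 1)) • (E4.basisVector 0 : E4)) :=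
  contDiff_const.add ((contDiff_const.mul (Real.contDiff_exp.sub contDiff_const)).smul
    contDiff_const)

/-- The velocity of the chart-vertical curve (as a curve in the manifold `E4`) is `δ eᵗ ∂₀`. -/
private theorem velocity_vert (x₀ : E4) (δ t : ℝ) :
    velocity 𝓘(ℝ, E4) (fun s : ℝ ↦ x₀ + (δ * (Real.exp s - 1)) • (E4.basisVector 0 : E4)) t =
      (δ * Real.exp t) • (E4.basisVector 0 : E4) := by
  simp only [velocity]
  rw [mfderiv_eq_fderiv, ← toSpanSingleton_deriv, (hasDerivAt_vert x₀ δ t).deriv]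
  exact one_smul ℝ _

/-- `B(a • w, a • w) = a² B(w, w)` for the metric at a point. -/
private theorem val_smul_smul {E : Type*} [NormedAddCommGroup E] [NormedSpace ℝ E] {H : Type*}
    [TopologicalSpace H] {I : ModelWithCorners ℝ E H} {n : ℕ∞ω} {M : Type*} [TopologicalSpace M]
    [ChartedSpace H M] [IsManifold I ∞ M] (g : LorentzianMetric I n M) (x : M) (a : ℝ)
    (w : TangentSpace I x) : g.val x (a • w) (a • w) = a * a * g.val x w w := by
  rw [map_smul, map_smul, smul_apply, smul_eq_mul, smul_eq_mul, mul_assoc]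

/-- Chain rule for velocities: `(f ∘ γ)'(t) = df_{γ t}(γ' t)`. -/
private theorem velocity_comp' {E' : Type*} [NormedAddCommGroup E'] [NormedSpace ℝ E']
    {H' : Type*} [TopologicalSpace H'] {I' : ModelWithCorners ℝ E' H'} {N : Type*}
    [TopologicalSpace N] [ChartedSpace H' N]
    {E : Type*} [NormedAddCommGroup E] [NormedSpace ℝ E] {H : Type*} [TopologicalSpace H]
    {I : ModelWithCorners ℝ E H} {M : Type*} [TopologicalSpace M] [ChartedSpace H M]
    {f : N → M} {γ : ℝ → N} {t : ℝ} (hf : MDifferentiableAt I' I f (γ t))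
    (hγ : MDifferentiableAt 𝓘(ℝ, ℝ) I' γ t) :
    velocity I (f ∘ γ) t = mfderiv I' I f (γ t) (velocity I' γ t) := by
  simp only [velocity]
  rw [mfderiv_comp t hf hγ]
  rfl

/-- **The lifted vertical ray and its velocity.** For a smooth chart map `Ψ : U₀ → 𝓢` and a curve
`c : ℝ → U₀` whose underlying `E4`-curve is the chart-vertical curve `s ↦ x₀ + δ(eˢ - 1) ∂₀`, the
lift `Ψ ∘ c` is smooth and its velocity at `t` is `δ eᵗ · dΨ_{c t}(∂₀)` (chain rule; the inclusion
`U₀ ↪ E4` has identity differential, `mfderiv_subtypeVal`). -/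
private theorem vertical_lift {𝓢 : Spacetime 4} {U₀ : Opens E4} {Ψ : U₀ → 𝓢.carrier}
    (hΨ : ContMDiff 𝓘(ℝ, E4) (𝓡 4) ∞ Ψ) (x₀ : E4) (δ : ℝ) {c : ℝ → U₀}
    (hc : ∀ s : ℝ, (c s : E4) = x₀ + (δ * (Real.exp s - 1)) • (E4.basisVector 0 : E4)) :
    ContMDiff 𝓘(ℝ, ℝ) (𝓡 4) ∞ (Ψ ∘ c) ∧ ∀ t : ℝ, MDifferentiableAt 𝓘(ℝ, ℝ) (𝓡 4) (Ψ ∘ c) t ∧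
      velocity (𝓡 4) (Ψ ∘ c) t =
        (δ * Real.exp t) • mfderiv 𝓘(ℝ, E4) (𝓡 4) Ψ (c t) (E4.basisVector 0) := by
  have hcv :
      Subtype.val ∘ c = (fun s : ℝ ↦ x₀ + (δ * (Real.exp s - 1)) • (E4.basisVector 0 : E4)) :=
    funext hc
  have hp_smooth : ContMDiff 𝓘(ℝ, ℝ) 𝓘(ℝ, E4) ∞
      (fun s : ℝ ↦ x₀ + (δ * (Real.exp s - 1)) • (E4.basisVector 0 : E4)) :=
    contMDiff_iff_contDiff.mpr (contDiff_vert x₀ δ)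
  have hc_smooth : ContMDiff 𝓘(ℝ, ℝ) 𝓘(ℝ, E4) ∞ c :=
    (ContMDiff.subtypeVal_comp_iff U₀ c).mp (hcv ▸ hp_smooth)
  have hγ : ContMDiff 𝓘(ℝ, ℝ) (𝓡 4) ∞ (Ψ ∘ c) := hΨ.comp hc_smooth
  refine ⟨hγ, fun t ↦ ⟨hγ.mdifferentiableAt (by simp), ?_⟩⟩
  have hct : MDifferentiableAt 𝓘(ℝ, ℝ) 𝓘(ℝ, E4) c t := hc_smooth.mdifferentiableAt (by simp)
  have hΨt : MDifferentiableAt 𝓘(ℝ, E4) (𝓡 4) Ψ (c t) := hΨ.mdifferentiableAt (by simp)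
  have hvc : velocity 𝓘(ℝ, E4) c t = (δ * Real.exp t) • (E4.basisVector 0 : E4) := by
    have h1 : velocity 𝓘(ℝ, E4) (Subtype.val ∘ c) t =
        mfderiv 𝓘(ℝ, E4) 𝓘(ℝ, E4) (Subtype.val : U₀ → E4) (c t) (velocity 𝓘(ℝ, E4) c t) :=
      velocity_comp' (hasMFDerivAt_subtypeVal (c t)).mdifferentiableAt hct
    rw [mfderiv_subtypeVal, hcv, velocity_vert] at h1
    exact h1.symm
  rw [velocity_comp' hΨt hct, hvc]
  exact (mfderiv 𝓘(ℝ, E4) (𝓡 4) Ψ (c t)).map_smul (δ * Real.exp t) (E4.basisVector 0)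

/-! ### The late image is past-full along the chart verticals -/

/-- **Chart-vertical chronology.** Let `Ψ₀ : U₀ → 𝓢` be a smooth chart map on an open
`U₀ ⊇ {x⁰ > τ₀}` of `E4` whose vertical differential `dΨ₀(∂₀)` is uniformly timelike,
`g(dΨ₀ ∂₀, dΨ₀ ∂₀) ≤ -3/4`, and future-directed at every late point. Then for every late point `x`
(`x⁰ > τ₀`) and every `s > 0` the point `Ψ₀(x + s ∂₀)` lies in the chronological future
`I⁺(Ψ₀ x)`: the vertical ray `r ↦ Ψ₀(x + δ(eʳ − 1)∂₀)`, `δ = x⁰ − τ₀`, is a future timelike curve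
on `[0, log (1 + s/δ)]` from `Ψ₀ x` to `Ψ₀(x + s ∂₀)` (O'Neill 1983, Ch. 14, p. 402). -/
theorem mem_chronologicalFuture_of_eq_add_smul {𝓢 : Spacetime 4} {U₀ : Opens E4}
    {Ψ₀ : U₀ → 𝓢.carrier} {τ₀ : ℝ} (hΨs : ContMDiff 𝓘(ℝ, E4) (𝓡 4) ∞ Ψ₀)
    (hU : {x : E4 | τ₀ < x 0} ⊆ (U₀ : Set E4))
    (hvert : ∀ y : U₀, τ₀ < y.1 0 →
      𝓢.metric.val (Ψ₀ y) (mfderiv 𝓘(ℝ, E4) (𝓡 4) Ψ₀ y (E4.basisVector 0))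
          (mfderiv 𝓘(ℝ, E4) (𝓡 4) Ψ₀ y (E4.basisVector 0)) ≤ -(3 / 4) ∧
        𝓢.timeOrientation.IsFutureDirected (mfderiv 𝓘(ℝ, E4) (𝓡 4) Ψ₀ y (E4.basisVector 0)))
    (x y : U₀) (hx : τ₀ < x.1 0) {s : ℝ} (hs : 0 < s)
    (hy : (y : E4) = x.1 + s • (E4.basisVector 0 : E4)) :
    Ψ₀ y ∈ 𝓢.metric.chronologicalFuture 𝓢.timeOrientation {Ψ₀ x} := by
  set g := 𝓢.metric with hg
  set τ := 𝓢.timeOrientation with hτ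
  -- the vertical ray through `x`
  set δ : ℝ := x.1 0 - τ₀ with hδ
  have hδpos : 0 < δ := sub_pos.mpr hx
  have hpt : ∀ r : ℝ, τ₀ < (x.1 + (δ * (Real.exp r - 1)) • (E4.basisVector 0 : E4)) 0 := by
    intro r
    rw [vert_apply_zero]
    have : 0 < δ * Real.exp r := mul_pos hδpos (Real.exp_pos r)
    linarith
  set c : ℝ → U₀ := fun r ↦ ⟨x.1 + (δ * (Real.exp r - 1)) • (E4.basisVector 0 : E4), hU (hpt r)⟩
    with hc
  have hcval : ∀ r : ℝ, (c r : E4) = x.1 + (δ * (Real.exp r - 1)) • (E4.basisVector 0 : E4) :=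
    fun r ↦ rfl
  have hc0 : c 0 = x := Subtype.ext (by simp [hc])
  have hclate : ∀ r : ℝ, τ₀ < (c r).1 0 := hpt
  obtain ⟨-, hvel⟩ := vertical_lift (𝓢 := 𝓢) hΨs x.1 δ (c := c) hcval
  set γ : ℝ → 𝓢.carrier := Ψ₀ ∘ c with hγdef
  -- the parameter `S = log (1 + s/δ) > 0` at which the ray reaches `x + s ∂₀`
  set S : ℝ := Real.log (1 + s / δ) with hS
  have hsδ : 0 < s / δ := div_pos hs hδpos
  have hS0 : 0 < S := Real.log_pos (by linarith)
  have hexpS : Real.exp S = 1 + s / δ := by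
    rw [hS]
    exact Real.exp_log (by linarith)
  have hcS : c S = y := by
    refine Subtype.ext ?_
    rw [hcval, hy, hexpS]
    congr 1
    congr 1
    field_simp
    ring
  -- the ray is a future timelike curve
  have hcurve : g.IsFutureTimelikeCurveOn τ γ (Icc 0 S) := by
    intro r _
    refine ⟨(hvel r).1, ?_, ?_⟩
    · show g.val (γ r) (velocity (𝓡 4) γ r) (velocity (𝓡 4) γ r) < 0
      have e : g.val (γ r) (velocity (𝓡 4) γ r) (velocity (𝓡 4) γ r) =
          δ * Real.exp r * (δ * Real.exp r) *
            g.val (Ψ₀ (c r)) (mfderiv 𝓘(ℝ, E4) (𝓡 4) Ψ₀ (c r) (E4.basisVector 0))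
              (mfderiv 𝓘(ℝ, E4) (𝓡 4) Ψ₀ (c r) (E4.basisVector 0)) := by
        rw [(hvel r).2]
        exact val_smul_smul g (γ r) (δ * Real.exp r) _
      rw [e]
      have h1 := (hvert (c r) (hclate r)).1
      have h3 : 0 < δ * Real.exp r * (δ * Real.exp r) :=
        mul_pos (mul_pos hδpos (Real.exp_pos r)) (mul_pos hδpos (Real.exp_pos r))
      exact mul_neg_of_pos_of_neg h3 (lt_of_le_of_lt h1 (by norm_num))
    · rw [(hvel r).2]
      exact (hvert (c r) (hclate r)).2.smul (mul_pos hδpos (Real.exp_pos r))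
  refine ⟨Ψ₀ x, mem_singleton _, γ, 0, S, hS0, hcurve, ?_, ?_⟩
  · show Ψ₀ (c 0) = Ψ₀ x
    rw [hc0]
  · show Ψ₀ (c S) = Ψ₀ y
    rw [hcS]

/-- **The late image is past-full**: in the setting of `mem_chronologicalFuture_of_eq_add_smul`,
for every `τ ≥ τ₀` the late image `W_τ = Ψ₀{x⁰ > τ}` satisfies `W_τ ⊆ I⁻(W_τ)` — every late point
`Ψ₀ x`, `x⁰ > τ`, lies in the chronological past of the later late point `Ψ₀(x + ∂₀)` (time duality,
O'Neill 1983, Ch. 14, p. 402). -/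
theorem image_lateRegion_subset_chronologicalPast {𝓢 : Spacetime 4} {U₀ : Opens E4}
    {Ψ₀ : U₀ → 𝓢.carrier} {τ₀ : ℝ} (hΨs : ContMDiff 𝓘(ℝ, E4) (𝓡 4) ∞ Ψ₀)
    (hU : {x : E4 | τ₀ < x 0} ⊆ (U₀ : Set E4))
    (hvert : ∀ y : U₀, τ₀ < y.1 0 →
      𝓢.metric.val (Ψ₀ y) (mfderiv 𝓘(ℝ, E4) (𝓡 4) Ψ₀ y (E4.basisVector 0))
          (mfderiv 𝓘(ℝ, E4) (𝓡 4) Ψ₀ y (E4.basisVector 0)) ≤ -(3 / 4) ∧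
        𝓢.timeOrientation.IsFutureDirected (mfderiv 𝓘(ℝ, E4) (𝓡 4) Ψ₀ y (E4.basisVector 0)))
    {τ : ℝ} (hτ : τ₀ ≤ τ) :
    Ψ₀ '' (Minkowski.backgroundOn U₀).lateRegion τ ⊆
      𝓢.metric.chronologicalPast 𝓢.timeOrientation
        (Ψ₀ '' (Minkowski.backgroundOn U₀).lateRegion τ) := by
  rintro q ⟨x, hx, rfl⟩
  have hxτ : τ < x.1 0 := hx
  have hx₀ : τ₀ < x.1 0 := lt_of_le_of_lt hτ hxτ
  -- the later vertical point `y = x + ∂₀`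
  have hy₀ : τ₀ < (x.1 + (1 : ℝ) • (E4.basisVector 0 : E4)) 0 := by
    simp only [one_smul, PiLp.add_apply]
    have : (E4.basisVector 0 : E4) 0 = 1 := by simp [E4.basisVector]
    rw [this]
    linarith
  set y : U₀ := ⟨x.1 + (1 : ℝ) • (E4.basisVector 0 : E4), hU hy₀⟩ with hy
  have hyτ : y ∈ (Minkowski.backgroundOn U₀).lateRegion τ := by
    show τ < (x.1 + (1 : ℝ) • (E4.basisVector 0 : E4)) 0
    simp only [one_smul, PiLp.add_apply]
    have : (E4.basisVector 0 : E4) 0 = 1 := by simp [E4.basisVector]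
    rw [this]
    linarith
  have hfut : Ψ₀ y ∈ 𝓢.metric.chronologicalFuture 𝓢.timeOrientation {Ψ₀ x} :=
    mem_chronologicalFuture_of_eq_add_smul hΨs hU hvert x y hx₀ one_pos rfl
  have hpast : Ψ₀ x ∈ 𝓢.metric.chronologicalPast 𝓢.timeOrientation {Ψ₀ y} :=
    LorentzianMetric.mem_chronologicalPast_of_mem_chronologicalFuture hfut
  exact LorentzianMetric.chronologicalFuture_mono
    (singleton_subset_iff.mpr (mem_image_of_mem Ψ₀ hyτ)) hpast

/-- **`exteriorOf` is monotone in the charted set** (`I⁻` is monotone; O'Neill 1983, Ch. 14,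
p. 402). -/
theorem exteriorOf_mono {X : Type} [TopologicalSpace X] [ChartedSpace E3 X]
    [IsManifold (𝓡 3) ∞ X] [ConnectedSpace X] {D : InitialDataSet (𝓡 3) X}
    (𝒟 : CauchyDevelopment D) {U U' : Set 𝒟.carrier} (h : U ⊆ U') :
    Summit.FinalStateConjecture.exteriorOf 𝒟 U ⊆ Summit.FinalStateConjecture.exteriorOf 𝒟 U' :=
  inter_subset_inter_right _ (LorentzianMetric.chronologicalFuture_mono h)

end Restart

/-- **Restart: the anchored hypothesis is inherited by every later initial time** (crux
stmt-FinalStateConjecture-14665, line `Sketch`; hypotheses = the crux's anchored conjuncts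
verbatim). If `Ψ₀ : U₀ → 𝒟` is an anchored flat late chart after time `τ₀` for the region
`O = exteriorOf 𝒟 (Ψ₀{x⁰ > τ₀})` of a maximal vacuum Cauchy development of admissible data, then
for every `τ > τ₀` it is an anchored flat late chart after time `τ` for the region
`exteriorOf 𝒟 (Ψ₀{x⁰ > τ})`, with the same exhaustion and anchor clauses from `τ` on: the five
conjuncts of the conclusion are those of the hypothesis with `τ₀ ↦ τ`,
`O ↦ exteriorOf 𝒟 (Ψ₀{x⁰ > τ})` (the third, now reflexive, is kept so that the conclusion is an
instance of the hypothesis shape). Geometric input: `Ψ₀{x⁰ > τ} ⊆ I⁻(Ψ₀{x⁰ > τ})` along the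
chart verticals (`Restart.image_lateRegion_subset_chronologicalPast`, from the landed
`stub_anchorCone`, `stub_chartFuture`, `FutureSet.val_mfderiv_basisVector_zero_le`). -/
theorem hyp_of_lt :
    ∀ (X : Type) [TopologicalSpace X] [ChartedSpace E3 X] [IsManifold (𝓡 3) ∞ X] [T2Space X]
      [SecondCountableTopology X] [ConnectedSpace X],
      ∀ D ∈ admissibleVacuumData X, ∀ 𝒟 : VacuumCauchyDevelopment D, 𝒟.IsMaximal →
        ∀ (O : Set 𝒟.carrier) (τ₀ : ℝ) (U₀ : Opens E4) (Ψ₀ : U₀ → 𝒟.carrier),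
          (𝒟.toSpacetime.IsLateChart (Minkowski.backgroundOn U₀) O τ₀ Ψ₀ ∧
            {x : E4 | τ₀ < x 0} ⊆ (U₀ : Set E4) ∧
            O = Summit.FinalStateConjecture.exteriorOf 𝒟.toCauchyDevelopment
              (Ψ₀ '' (Minkowski.backgroundOn U₀).lateRegion τ₀) ∧
            (∀ τ₁ : ℝ, τ₀ < τ₁ → O \ Ψ₀ '' (Minkowski.backgroundOn U₀).lateRegion τ₁ ⊆
              𝒟.metric.causalPast 𝒟.timeOrientation
                (Ψ₀ '' (Minkowski.backgroundOn U₀).timeSlab τ₁)) ∧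
            (∀ τ : ℝ, τ₀ < τ → 𝒟.toSpacetime.deviationCk (Minkowski.backgroundOn U₀) Ψ₀ 0 τ ≤
              ENNReal.ofReal (1 / 4))) →
          ∀ τ : ℝ, τ₀ < τ →
            (𝒟.toSpacetime.IsLateChart (Minkowski.backgroundOn U₀)
                (Summit.FinalStateConjecture.exteriorOf 𝒟.toCauchyDevelopment
                  (Ψ₀ '' (Minkowski.backgroundOn U₀).lateRegion τ)) τ Ψ₀ ∧
              {x : E4 | τ < x 0} ⊆ (U₀ : Set E4) ∧
              Summit.FinalStateConjecture.exteriorOf 𝒟.toCauchyDevelopment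
                  (Ψ₀ '' (Minkowski.backgroundOn U₀).lateRegion τ) =
                Summit.FinalStateConjecture.exteriorOf 𝒟.toCauchyDevelopment
                  (Ψ₀ '' (Minkowski.backgroundOn U₀).lateRegion τ) ∧
              (∀ τ₁ : ℝ, τ < τ₁ →
                Summit.FinalStateConjecture.exteriorOf 𝒟.toCauchyDevelopment
                    (Ψ₀ '' (Minkowski.backgroundOn U₀).lateRegion τ) \
                  Ψ₀ '' (Minkowski.backgroundOn U₀).lateRegion τ₁ ⊆
                𝒟.metric.causalPast 𝒟.timeOrientation
                  (Ψ₀ '' (Minkowski.backgroundOn U₀).timeSlab τ₁)) ∧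
              (∀ τ' : ℝ, τ < τ' →
                𝒟.toSpacetime.deviationCk (Minkowski.backgroundOn U₀) Ψ₀ 0 τ' ≤
                  ENNReal.ofReal (1 / 4))) := by
  intro X _ _ _ _ _ _ D hD 𝒟 hmax O τ₀ U₀ Ψ₀ hyp τ hτ
  -- the pointwise anchor and the orientation of chart time (landed neighbours)
  have hdev : ∀ y : U₀, τ₀ < y.1 0 →
      ‖𝒟.toSpacetime.deviation (Minkowski.backgroundOn U₀) Ψ₀ y‖ ≤ 1 / 4 :=
    stub_anchorCone X D hD 𝒟 hmax O τ₀ U₀ Ψ₀ hyp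
  have hfut : ∀ y : U₀, τ₀ < y.1 0 →
      𝒟.timeOrientation.IsFutureDirected (mfderiv 𝓘(ℝ, E4) (𝓡 4) Ψ₀ y (E4.basisVector 0)) :=
    stub_chartFuture stub_anchorCone X D hD 𝒟 hmax O τ₀ U₀ Ψ₀ hyp
  obtain ⟨hchart, hU, hO, hexh, hC0⟩ := hyp
  have hvert : ∀ y : U₀, τ₀ < y.1 0 →
      𝒟.metric.val (Ψ₀ y) (mfderiv 𝓘(ℝ, E4) (𝓡 4) Ψ₀ y (E4.basisVector 0))
          (mfderiv 𝓘(ℝ, E4) (𝓡 4) Ψ₀ y (E4.basisVector 0)) ≤ -(3 / 4) ∧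
        𝒟.timeOrientation.IsFutureDirected (mfderiv 𝓘(ℝ, E4) (𝓡 4) Ψ₀ y (E4.basisVector 0)) :=
    fun y hy ↦ ⟨FutureSet.val_mfderiv_basisVector_zero_le Ψ₀ y (hdev y hy), hfut y hy⟩
  -- notation: `W_σ = Ψ₀{x⁰ > σ}`
  have hsub : (Minkowski.backgroundOn U₀).lateRegion τ ⊆ (Minkowski.backgroundOn U₀).lateRegion τ₀ :=
    (Minkowski.backgroundOn U₀).lateRegion_mono hτ.le
  have hWW : Ψ₀ '' (Minkowski.backgroundOn U₀).lateRegion τ ⊆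
      Ψ₀ '' (Minkowski.backgroundOn U₀).lateRegion τ₀ := image_mono hsub
  -- `exteriorOf 𝒟 W_τ ⊆ exteriorOf 𝒟 W = O`
  have hOO : Summit.FinalStateConjecture.exteriorOf 𝒟.toCauchyDevelopment
      (Ψ₀ '' (Minkowski.backgroundOn U₀).lateRegion τ) ⊆ O := by
    rw [hO]
    exact Restart.exteriorOf_mono 𝒟.toCauchyDevelopment hWW
  refine ⟨⟨hchart.contMDiff, ?_, ?_⟩, fun x hx ↦ hU (lt_trans hτ hx), rfl, ?_, ?_⟩
  · -- the open embedding restricts from `{x⁰ > τ₀}` to its open subset `{x⁰ > τ}`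
    have hopen : IsOpen ((Minkowski.backgroundOn U₀).lateRegion τ) := by
      have hcont : Continuous fun x : U₀ ↦ (x : E4) 0 :=
        (PiLp.continuous_apply 2 _ 0).comp continuous_subtype_val
      exact isOpen_lt continuous_const hcont
    have hincl : Topology.IsOpenEmbedding (inclusion hsub) :=
      Topology.IsOpenEmbedding.inclusion hsub (hopen.preimage continuous_subtype_val)
    exact hchart.isOpenEmbedding.comp hincl
  · -- `W_τ ⊆ J⁺(Σ) ∩ I⁻(W_τ)`
    intro q hq
    have hqO : q ∈ O := hchart.image_subset (hWW hq)
    rw [hO] at hqO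
    exact ⟨hqO.1, Restart.image_lateRegion_subset_chronologicalPast (𝓢 := 𝒟.toSpacetime)
      hchart.contMDiff hU hvert hτ.le hq⟩
  · -- exhaustion from `τ` on
    intro τ₁ hτ₁ q hq
    exact hexh τ₁ (hτ.trans hτ₁) ⟨hOO hq.1, hq.2⟩
  · -- anchor from `τ` on
    exact fun τ' hτ' ↦ hC0 τ' (hτ.trans hτ')

end Summit.FinalStateConjecture.FinalStateConjecture.Theorems.RecurrentlyFlatDisperses

end
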